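import Mathlib
import Summits.Ventures.PercRepro2.CaseOneDWorld

/-!
# 2′CD-o — the o-AVOIDING form of row 2′CD with the C₂-only constant: definitions (blind cell PercRepro2,
mine-a g13; MINE-A.md §56.5 / §56.8; INBOX 2026-08-25T08:4xZ; the lead's ruling 08:40:31Z: candidate lemma)

D-world `D = Q ∩ {a₃ ∉ C₂}` (`CaseOne.Dw`, mine-a's (DOM-D) world), `f = 1[o ∈ C₂]`, and the
**o-avoiding a₃-connection** `e⁻ᵒ = 1[a₃ ∈ C_{G−o}(a₁)]` (`eAvoid`: the induced graph on `V ∖ {o}`,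
`QEvent`), so that `e⁻ᵒ ≤ e = 1[a₃ ∈ C₁]` (`eAvoid_subset_connEvent`) and `e · f = e⁻ᵒ · f` on `D`
(paper: `o ∈ C₂` forces `o ∉ C₁`, so every open `a₁–a₃` path avoids `o`; not proved here).

* `cdoExpr κ 𝓤 = P(D)·E[1_𝓤(C₁) e⁻ᵒ (κ − f) 1_D] − E[1_𝓤(C₁) 1_D]·E[e⁻ᵒ (κ − f) 1_D]`
  `= P(D)² · Cov_D(1_𝓤(C₁), e⁻ᵒ(κ − f))`, cleared;
* `gamma2o = P(o ∈ C₂ ∣ D, e⁻ᵒ = 0)` (the C₂-only constant of record; `gamma2 = P(o ∈ C₂ ∣ PD)` is the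
  NEG-119 constant, `CovForm`'s `Do`-type quantities in the `PDEvent` world);
* **`CDo`** (namespace `CDoForm`): `0 ≤ cdoExpr gamma2o 𝓤` for every up-set `𝓤` of vertex sets — row 2′CD's left-hand side
  (`e f = e⁻ᵒ f`) against `γ₂′ · Cov_D(1_𝓤, e⁻ᵒ)`.  Census: exhaustive binary-extreme `n = 6`, `{1,7}/8`,
  ALL up-sets by max-flow closure, `0 / 10,822,912` live four-markings (kit j236158; the `{1,127}/128`
  palette j236341), `n = 5` both palettes `0 / 343,360` (j236159); with `κ = P(o ∈ C₂ ∣ D)` it FAILS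
  (120,577 at `n = 6`; an `n = 7` hand witness).  Together with the bridge
  `(γ − γ₂′)·Cov_D(1_𝓤, e⁻ᵒ) + γ·Cov_D(1_𝓤, e − e⁻ᵒ) ≥ 0` (0 failures, same scope) it is row 2′CD identically.
A definition only; nothing about `CDo` itself is claimed. -/

namespace Summit.Ventures.PercRepro2

open UnionCluster

namespace CDoForm

section Defs

variable {V : Type*} {E : Type*} [Fintype E] [DecidableEq E] [Fintype V] [DecidableEq V]
  {R : Type*} [Field R] [LinearOrder R] [IsStrictOrderedRing R]

variable (p : E → R) (ends : E → Sym2 V) (o a₁ a₂ a₃ : V)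

/-- `e⁻ᵒ = {a₃ ∈ C_{G−o}(a₁)}`: `a₁ ↔ a₃` in the induced graph on `V ∖ {o}`. -/
def eAvoid : Set (Config E) := QEvent ends (Finset.univ.erase o) a₁ {a₃}

omit [Fintype E] [DecidableEq E] in
/-- `e⁻ᵒ ⊆ e`: a connection avoiding `o` is a connection. -/
lemma eAvoid_subset_connEvent : eAvoid ends o a₁ a₃ ⊆ connEvent ends a₁ a₃ := by
  intro ω hω
  have h := hω a₃ (Finset.mem_singleton_self a₃)
  exact conn_mono (induced_le (ends := ends) _ ω) h

local notation3 "D" => CaseOne.Dw ends a₁ a₂ a₃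
local notation3 "𝟙D" => (CaseOne.Dw ends a₁ a₂ a₃).indicator (1 : Config E → R)
local notation3 "𝟙e'" => (eAvoid ends o a₁ a₃).indicator (1 : Config E → R)
local notation3 "𝟙f" => (connEvent ends a₂ o).indicator (1 : Config E → R)

/-- `P(D)² · Cov_D(1_𝓤(C₁), e⁻ᵒ·(κ − f))`, cleared: `P(D)·E[1_𝓤(C₁) e⁻ᵒ (κ − f) 1_D] − E[1_𝓤(C₁) 1_D]·E[e⁻ᵒ (κ − f) 1_D]`. -/
noncomputable def cdoExpr (κ : R) (𝓤 : Set (Set V)) : R :=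
  prob p D *
      expect p (fun ω => 𝓤.indicator (1 : Set V → R) (cluster ends ω a₁) * 𝟙e' ω * (κ - 𝟙f ω) * 𝟙D ω) -
    expect p (fun ω => 𝓤.indicator (1 : Set V → R) (cluster ends ω a₁) * 𝟙D ω) *
      expect p (fun ω => 𝟙e' ω * (κ - 𝟙f ω) * 𝟙D ω)

/-- `γ₂′ = P(o ∈ C₂ ∣ D, e⁻ᵒ = 0)` (the C₂-only constant of record of 2′CD-o). -/
noncomputable def gamma2o : R :=
  prob p (D ∩ (eAvoid ends o a₁ a₃)ᶜ ∩ connEvent ends a₂ o) / prob p (D ∩ (eAvoid ends o a₁ a₃)ᶜ)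

/-- `γ₂ = P(o ∈ C₂ ∣ D, e = 0) = P(o ∈ C₂ ∣ PD)`, the NEG-119 constant (2′CD-o also holds with it on the scope tested). -/
noncomputable def gamma2 : R :=
  prob p (D ∩ (connEvent ends a₁ a₃)ᶜ ∩ connEvent ends a₂ o) / prob p (D ∩ (connEvent ends a₁ a₃)ᶜ)

/-- **2′CD-o**: `0 ≤ cdoExpr γ₂′ 𝓤` for every up-set `𝓤` of vertex sets (mine-a g13 candidate lemma; MINE-A.md §56.8). -/
def CDo : Prop :=
  ∀ 𝓤 : Set (Set V), IsUpperSet 𝓤 → 0 ≤ cdoExpr p ends o a₁ a₂ a₃ (gamma2o p ends o a₁ a₂ a₃) 𝓤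

/-- The same statement with the NEG-119 constant `γ₂` (weaker when `γ₂ ≥ γ₂′`; census-true on the same scope). -/
def CDo₂ : Prop :=
  ∀ 𝓤 : Set (Set V), IsUpperSet 𝓤 → 0 ≤ cdoExpr p ends o a₁ a₂ a₃ (gamma2 p ends o a₁ a₂ a₃) 𝓤

end Defs

end CDoForm

end Summit.Ventures.PercRepro2
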